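import Summits.Ventures.Crystal3D.Theorems.StickyWulffConstantGenericWallFloorCapRigidity
import HarnessLib

/-!
# Three vacancies in the fcc kissing shell, part 1: the two core patterns in Gram coordinates

HONEST FRAMING. Part of the venture `Summits/Ventures/Crystal3D` (cell `crystal3d-full`), helper
`--supports` the crux `CoaxialWallLaw` (stmt-Ventures-19481, `route-Ventures-StickyWulffConstant`),
REGISTERED line `WallLedgerF` (planner cf-p1 gen 16), stub `stub_coaxialTwoSlabAdhesion`
(terrace/riser slot ledger, absorption of foreign contacts).  Continues the chain
`…CoaxialWallLawSingleVacancy` (`k = 1`), `…CoaxialWallLawDoubleVacancy` (`k = 2`) with the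
`k = 3` atom.  A lattice ball with THREE vacant slots `v₁, v₂, v₃` (cubic frame of `D₃`: slots are
the twelve `(±1,±1,0)`-type integer triples, contact directions are real triples of norm² `2`,
«compatible with slot `s`» = «inner product with `s` at most `1`») and three mutually compatible
foreign contact directions: part 2 (`…TripleVacancy`) reduces this to two patterns of the vacant
triple — a TRIANGULAR FACE (`⟨vᵢ, vⱼ⟩ = 1` pairwise) or an «L» in a square face
(`⟨v₁, v₂⟩ = 0`, `⟨v₁, v₃⟩ = ⟨v₂, v₃⟩ = 1`) — and this file settles both patterns by real
arithmetic in the GRAM COORDINATES `P = ⟨x, v₁⟩, Q = ⟨x, v₂⟩, R = ⟨x, v₃⟩` of a direction `x`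
(so no case split over the 8 faces / 24 L's is needed: the norm and the mutual inner products are
quadratic forms in `P, Q, R` with the same integer coefficients for every face, resp. every L):

* `cubicFace_height` — over a face, a direction compatible with the nine other slots
  (`|P−Q|, |Q−R|, |P−R| ≤ 1` from the six equatorial slots `±(vᵢ − vⱼ)`, `P, Q, R ≥ −1` from the
  three antipodes `−vᵢ`) has HEIGHT `P + Q + R ≥ 4` (= `2√3·⟨x, n⟩` with `n` the unit face
  normal: the `(111)` cap lemma in Gram form, via `hexagon_quadratic_le`);
* `cubicFace_rim` — at height exactly `4` the direction is one of SIX points: the three face slots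
  (`(P,Q,R) = (2,1,1), (1,2,1), (1,1,2)`) or the three TWIN positions
  (`(5/3,5/3,2/3), (5/3,2/3,5/3), (2/3,5/3,5/3)`) (`hexagon_quadratic_eq`);
* `cubicFace_triple` — three mutually compatible such directions all have height `4`
  (`Σ heights ≤ 12` from `‖x+y+z‖² ≤ 12` and Cauchy–Schwarz, both written in Gram form);
* `cubicL_triple_false` — over an L, three mutually compatible directions, each blocking at least
  two of the three vacant slots, do not exist.

Ledger reading (with part 2 and the twin-lattice exclusion): a lattice ball with three vacancies is
saturated by foreign contacts only in the face-twin pattern.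
WHAT THIS IS NOT: the reduction to the two patterns (part 2), the lattice form, the stub; rung F-C1
not moved.
-/

noncomputable section

namespace Summit.Ventures.Crystal3D.Theorems

set_option maxHeartbeats 400000 in
/-- **Cap lemma over a triangular face, Gram coordinates.**  `3(P²+Q²+R²) − 2(PQ+QR+RP) = 8` is
`‖x‖² = 2` for `P, Q, R` the inner products of `x` with the three face slots; compatibility with
the six equatorial slots and the three antipodal slots forces `P + Q + R ≥ 4`. -/
theorem cubicFace_height (P Q R : ℝ)
    (hn : 3 * (P ^ 2 + Q ^ 2 + R ^ 2) - 2 * (P * Q + Q * R + R * P) = 8)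
    (h1 : P - Q ≤ 1) (h2 : Q - P ≤ 1) (h3 : P - R ≤ 1) (h4 : R - P ≤ 1) (h5 : Q - R ≤ 1)
    (h6 : R - Q ≤ 1) (h7 : -1 ≤ P) (h8 : -1 ≤ Q) (h9 : -1 ≤ R) : 4 ≤ P + Q + R := by
  have hy : |(P - Q) / 2| ≤ 1 / 2 := abs_le.2 ⟨by linarith, by linarith⟩
  have hz : |(Q - R) / 2| ≤ 1 / 2 := abs_le.2 ⟨by linarith, by linarith⟩
  have hyz : |(P - Q) / 2 + (Q - R) / 2| ≤ 1 / 2 := abs_le.2 ⟨by linarith, by linarith⟩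
  have hq := hexagon_quadratic_le ((P - Q) / 2) ((Q - R) / 2) hy hz hyz
  have hS : 6 ≤ P ^ 2 + Q ^ 2 + R ^ 2 := by nlinarith [hq, hn]
  have hT : 16 ≤ (P + Q + R) ^ 2 := by nlinarith [hS, hn]
  nlinarith [hT, h7, h8, h9]

/-- **The rim of the face cap.**  At height exactly `4` the direction is a face slot or a twin
position (in Gram coordinates). -/
theorem cubicFace_rim (P Q R : ℝ)
    (hn : 3 * (P ^ 2 + Q ^ 2 + R ^ 2) - 2 * (P * Q + Q * R + R * P) = 8)
    (h1 : P - Q ≤ 1) (h2 : Q - P ≤ 1) (h3 : P - R ≤ 1) (h4 : R - P ≤ 1) (h5 : Q - R ≤ 1)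
    (h6 : R - Q ≤ 1) (hT : P + Q + R = 4) :
    (P = 2 ∧ Q = 1 ∧ R = 1) ∨ (P = 1 ∧ Q = 2 ∧ R = 1) ∨ (P = 1 ∧ Q = 1 ∧ R = 2) ∨
      (P = 5 / 3 ∧ Q = 5 / 3 ∧ R = 2 / 3) ∨ (P = 5 / 3 ∧ Q = 2 / 3 ∧ R = 5 / 3) ∨
      (P = 2 / 3 ∧ Q = 5 / 3 ∧ R = 5 / 3) := by
  have hy : |(P - Q) / 2| ≤ 1 / 2 := abs_le.2 ⟨by linarith, by linarith⟩
  have hz : |(Q - R) / 2| ≤ 1 / 2 := abs_le.2 ⟨by linarith, by linarith⟩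
  have hyz : |(P - Q) / 2 + (Q - R) / 2| ≤ 1 / 2 := abs_le.2 ⟨by linarith, by linarith⟩
  have hS : P ^ 2 + Q ^ 2 + R ^ 2 = 6 := by nlinarith [hn, hT]
  have heq : ((P - Q) / 2) ^ 2 + (P - Q) / 2 * ((Q - R) / 2) + ((Q - R) / 2) ^ 2 = 1 / 4 := by
    nlinarith [hn, hT, hS]
  rcases hexagon_quadratic_eq ((P - Q) / 2) ((Q - R) / 2) hy hz hyz heq with h | h | h
  · -- `P = R`, `Q = 4 − 2R`, `3R² − 8R + 5 = 0`
    have hP : P = R := by linarith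
    have hQ : Q = 4 - 2 * R := by linarith
    rw [hP, hQ] at hS
    have hpoly : (R - 1) * (3 * R - 5) = 0 := by nlinarith [hS]
    rcases mul_eq_zero.1 hpoly with h0 | h0
    · right; left
      exact ⟨by linarith, by linarith, by linarith⟩
    · right; right; right; right; left
      exact ⟨by linarith, by linarith, by linarith⟩
  · -- `P = R + 1`, `Q = 3 − 2R`, `3R² − 5R + 2 = 0`
    have hP : P = R + 1 := by linarith
    have hQ : Q = 3 - 2 * R := by linarith
    rw [hP, hQ] at hS
    have hpoly : (R - 1) * (3 * R - 2) = 0 := by nlinarith [hS]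
    rcases mul_eq_zero.1 hpoly with h0 | h0
    · left
      exact ⟨by linarith, by linarith, by linarith⟩
    · right; right; right; left
      exact ⟨by linarith, by linarith, by linarith⟩
  · -- `P = R − 1`, `Q = 5 − 2R`, `3R² − 11R + 10 = 0`
    have hP : P = R - 1 := by linarith
    have hQ : Q = 5 - 2 * R := by linarith
    rw [hP, hQ] at hS
    have hpoly : (R - 2) * (3 * R - 5) = 0 := by nlinarith [hS]
    rcases mul_eq_zero.1 hpoly with h0 | h0
    · right; right; left
      exact ⟨by linarith, by linarith, by linarith⟩
    · right; right; right; right; right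
      exact ⟨by linarith, by linarith, by linarith⟩

/-- **Three compatible directions over a triangular face sit on the rim.**  Three directions
`x, y, z` (Gram coordinates `(P,Q,R)`, `(P',Q',R')`, `(P'',Q'',R'')`), each of norm² `2` and
compatible with the nine slots off the face, pairwise compatible
(`4⟨x, y⟩ = 3(PP'+QQ'+RR') − (PQ'+P'Q+QR'+Q'R+RP'+R'P) ≤ 4`), all have height `4`. -/
theorem cubicFace_triple (P Q R P' Q' R' P'' Q'' R'' : ℝ)
    (hn : 3 * (P ^ 2 + Q ^ 2 + R ^ 2) - 2 * (P * Q + Q * R + R * P) = 8)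
    (hn' : 3 * (P' ^ 2 + Q' ^ 2 + R' ^ 2) - 2 * (P' * Q' + Q' * R' + R' * P') = 8)
    (hn'' : 3 * (P'' ^ 2 + Q'' ^ 2 + R'' ^ 2) - 2 * (P'' * Q'' + Q'' * R'' + R'' * P'') = 8)
    (h1 : P - Q ≤ 1) (h2 : Q - P ≤ 1) (h3 : P - R ≤ 1) (h4 : R - P ≤ 1) (h5 : Q - R ≤ 1)
    (h6 : R - Q ≤ 1) (h7 : -1 ≤ P) (h8 : -1 ≤ Q) (h9 : -1 ≤ R)
    (h1' : P' - Q' ≤ 1) (h2' : Q' - P' ≤ 1) (h3' : P' - R' ≤ 1) (h4' : R' - P' ≤ 1)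
    (h5' : Q' - R' ≤ 1) (h6' : R' - Q' ≤ 1) (h7' : -1 ≤ P') (h8' : -1 ≤ Q') (h9' : -1 ≤ R')
    (h1'' : P'' - Q'' ≤ 1) (h2'' : Q'' - P'' ≤ 1) (h3'' : P'' - R'' ≤ 1) (h4'' : R'' - P'' ≤ 1)
    (h5'' : Q'' - R'' ≤ 1) (h6'' : R'' - Q'' ≤ 1) (h7'' : -1 ≤ P'') (h8'' : -1 ≤ Q'')
    (h9'' : -1 ≤ R'')
    (hxy : 3 * (P * P' + Q * Q' + R * R') -
      (P * Q' + P' * Q + Q * R' + Q' * R + R * P' + R' * P) ≤ 4)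
    (hxz : 3 * (P * P'' + Q * Q'' + R * R'') -
      (P * Q'' + P'' * Q + Q * R'' + Q'' * R + R * P'' + R'' * P) ≤ 4)
    (hyz : 3 * (P' * P'' + Q' * Q'' + R' * R'') -
      (P' * Q'' + P'' * Q' + Q' * R'' + Q'' * R' + R' * P'' + R'' * P') ≤ 4) :
    P + Q + R = 4 ∧ P' + Q' + R' = 4 ∧ P'' + Q'' + R'' = 4 := by
  have hT := cubicFace_height P Q R hn h1 h2 h3 h4 h5 h6 h7 h8 h9
  have hT' := cubicFace_height P' Q' R' hn' h1' h2' h3' h4' h5' h6' h7' h8' h9'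
  have hT'' := cubicFace_height P'' Q'' R'' hn'' h1'' h2'' h3'' h4'' h5'' h6'' h7'' h8'' h9''
  -- Gram coordinates `Wᵢ` of `w = x + y + z`
  obtain ⟨W₁, hW₁⟩ : ∃ W₁ : ℝ, W₁ = P + P' + P'' := ⟨_, rfl⟩
  obtain ⟨W₂, hW₂⟩ : ∃ W₂ : ℝ, W₂ = Q + Q' + Q'' := ⟨_, rfl⟩
  obtain ⟨W₃, hW₃⟩ : ∃ W₃ : ℝ, W₃ = R + R' + R'' := ⟨_, rfl⟩
  -- `4‖w‖² = 3 Σ Wᵢ² − 2 Σ WᵢWⱼ ≤ 3·8 + 2·3·4 = 48`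
  have hw : 3 * (W₁ ^ 2 + W₂ ^ 2 + W₃ ^ 2) - 2 * (W₁ * W₂ + W₂ * W₃ + W₃ * W₁) ≤ 48 := by
    rw [hW₁, hW₂, hW₃]; linarith [hn, hn', hn'', hxy, hxz, hyz]
  -- Cauchy–Schwarz `(W₁+W₂+W₃)² ≤ 3 Σ Wᵢ²`
  have hcs : (W₁ + W₂ + W₃) ^ 2 ≤ 3 * (W₁ ^ 2 + W₂ ^ 2 + W₃ ^ 2) := by
    have hid : 3 * (W₁ ^ 2 + W₂ ^ 2 + W₃ ^ 2) - (W₁ + W₂ + W₃) ^ 2 =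
        (W₁ - W₂) ^ 2 + (W₂ - W₃) ^ 2 + (W₁ - W₃) ^ 2 := by ring
    linarith [sq_nonneg (W₁ - W₂), sq_nonneg (W₂ - W₃), sq_nonneg (W₁ - W₃), hid]
  -- `2 Σ WᵢWⱼ = (ΣW)² − ΣW²`, so `4 ΣW² − (ΣW)² ≤ 48` and `(ΣW)² ≤ 144`
  have hT2 : (W₁ + W₂ + W₃ - 12) * (W₁ + W₂ + W₃ + 12) ≤ 0 := by linarith [hw, hcs]
  have hsum : W₁ + W₂ + W₃ ≤ 12 := by
    by_contra hlt
    push Not at hlt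
    have hpos : 0 < (W₁ + W₂ + W₃ - 12) * (W₁ + W₂ + W₃ + 12) :=
      mul_pos (by linarith) (by linarith)
    linarith
  have hsum' : W₁ + W₂ + W₃ = (P + Q + R) + (P' + Q' + R') + (P'' + Q'' + R'') := by
    rw [hW₁, hW₂, hW₃]; ring
  exact ⟨by linarith, by linarith, by linarith⟩

/-- The square-face frame of an «L» (`v₁ ⊥ v₂`, `v₃` adjacent to both): for a direction of norm² `2`
in Gram coordinates `(P, Q, R)` compatible with `v₄ = v₁ + v₂ − v₃` and `±(v₃ − v₁)`,
`±(v₃ − v₂)` that blocks at least two of `v₁, v₂, v₃`, the coordinates `a = (P+Q)/2`,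
`c = R − (P+Q)/2` satisfy `a ≥ 1`, `c ≥ 0` and `R = a + c > 1`. -/
theorem cubicL_frame (P Q R : ℝ) (hn : (P + Q) ^ 2 + (P - Q) ^ 2 + (2 * R - P - Q) ^ 2 = 8)
    (h1 : P + Q - R ≤ 1) (h2 : R - Q ≤ 1) (h3 : Q - R ≤ 1) (h4 : R - P ≤ 1) (h5 : P - R ≤ 1)
    (hb13 : 1 < P ∨ 1 < R) (hb23 : 1 < Q ∨ 1 < R) :
    2 ≤ P + Q ∧ 0 ≤ 2 * R - P - Q ∧ 1 < R := by
  -- `R > 1`: otherwise `P, Q > 1` and `P + Q − R > 1`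
  have hR : 1 < R := by
    by_contra hR
    push Not at hR
    have hP : 1 < P := hb13.resolve_right (not_lt.2 hR)
    have hQ : 1 < Q := hb23.resolve_right (not_lt.2 hR)
    linarith
  obtain ⟨a, ha⟩ : ∃ a : ℝ, a = (P + Q) / 2 := ⟨_, rfl⟩
  obtain ⟨b, hb⟩ : ∃ b : ℝ, b = (P - Q) / 2 := ⟨_, rfl⟩
  obtain ⟨c, hc⟩ : ∃ c : ℝ, c = R - (P + Q) / 2 := ⟨_, rfl⟩
  have e1 : P + Q = 2 * a := by linarith
  have e2 : P - Q = 2 * b := by linarith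
  have e3 : 2 * R - P - Q = 2 * c := by linarith
  rw [e1, e2, e3] at hn
  have hnabc : a ^ 2 + b ^ 2 + c ^ 2 = 2 := by linarith [hn]
  have hbc1 : b + c ≤ 1 := by linarith
  have hbc2 : -b + c ≤ 1 := by linarith
  have hbc3 : b - c ≤ 1 := by linarith
  have hbc4 : -b - c ≤ 1 := by linarith
  have hac : a - c ≤ 1 := by linarith
  have hac' : 1 < a + c := by linarith
  -- `b² + c² ≤ 1`, hence `a² ≥ 1`
  have hbc : b ^ 2 + c ^ 2 ≤ 1 := by
    rcases le_total 0 b with hb0 | hb0 <;> rcases le_total 0 c with hc0 | hc0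
    · nlinarith [mul_nonneg hb0 hc0]
    · nlinarith [mul_nonpos_iff.2 (Or.inl ⟨hb0, hc0⟩)]
    · nlinarith [mul_nonpos_iff.2 (Or.inr ⟨hb0, hc0⟩)]
    · nlinarith [mul_nonneg_of_nonpos_of_nonpos hb0 hc0]
  have ha2 : 1 ≤ a ^ 2 := by linarith
  have hc1 : c ≤ 1 := by linarith
  -- `a ≥ 1` (if `a ≤ −1` then `c > 2`)
  have ha1 : 1 ≤ a := by
    by_contra hlt
    push Not at hlt
    by_cases h' : a + 1 ≤ 0
    · linarith
    · push Not at h'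
      have : (a - 1) * (a + 1) < 0 := mul_neg_of_neg_of_pos (by linarith) h'
      nlinarith [ha2]
  exact ⟨by linarith, by linarith, hR⟩

/-- **No saturating triple over an «L».**  Vacant slots `v₁, v₂, v₃` with `⟨v₁,v₂⟩ = 0`,
`⟨v₁,v₃⟩ = ⟨v₂,v₃⟩ = 1` (three vertices of a square face; `v₄ = v₁ + v₂ − v₃` the fourth).  In
the Gram coordinates `(P, Q, R)` of a direction `x` of norm² `2` one has
`4‖x‖² = (P+Q)² + (P−Q)² + (2R−P−Q)²` and
`4⟨x, x'⟩ = (P+Q)(P'+Q') + (P−Q)(P'−Q') + (2R−P−Q)(2R'−P'−Q')`; compatibility with the nine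
other slots includes `P+Q−R ≤ 1` (`v₄`), `|R−Q| ≤ 1` (`±(v₃−v₂)`), `|R−P| ≤ 1` (`±(v₃−v₁)`).
Three pairwise compatible such directions, each blocking at least two of `v₁, v₂, v₃` (every pair
of vacant slots contains a blocked one), do not exist. -/
theorem cubicL_triple_false (P Q R P' Q' R' P'' Q'' R'' : ℝ)
    (hn : (P + Q) ^ 2 + (P - Q) ^ 2 + (2 * R - P - Q) ^ 2 = 8)
    (hn' : (P' + Q') ^ 2 + (P' - Q') ^ 2 + (2 * R' - P' - Q') ^ 2 = 8)
    (hn'' : (P'' + Q'') ^ 2 + (P'' - Q'') ^ 2 + (2 * R'' - P'' - Q'') ^ 2 = 8)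
    (h1 : P + Q - R ≤ 1) (h2 : R - Q ≤ 1) (h3 : Q - R ≤ 1) (h4 : R - P ≤ 1) (h5 : P - R ≤ 1)
    (h1' : P' + Q' - R' ≤ 1) (h2' : R' - Q' ≤ 1) (h3' : Q' - R' ≤ 1) (h4' : R' - P' ≤ 1)
    (h5' : P' - R' ≤ 1)
    (h1'' : P'' + Q'' - R'' ≤ 1) (h2'' : R'' - Q'' ≤ 1) (h3'' : Q'' - R'' ≤ 1)
    (h4'' : R'' - P'' ≤ 1) (h5'' : P'' - R'' ≤ 1)
    (hb13 : 1 < P ∨ 1 < R) (hb23 : 1 < Q ∨ 1 < R)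
    (hb13' : 1 < P' ∨ 1 < R') (hb23' : 1 < Q' ∨ 1 < R')
    (hb13'' : 1 < P'' ∨ 1 < R'') (hb23'' : 1 < Q'' ∨ 1 < R'')
    (hxy : (P + Q) * (P' + Q') + (P - Q) * (P' - Q') + (2 * R - P - Q) * (2 * R' - P' - Q') ≤ 4)
    (hxz : (P + Q) * (P'' + Q'') + (P - Q) * (P'' - Q'') +
      (2 * R - P - Q) * (2 * R'' - P'' - Q'') ≤ 4)
    (hyz : (P' + Q') * (P'' + Q'') + (P' - Q') * (P'' - Q'') +
      (2 * R' - P' - Q') * (2 * R'' - P'' - Q'') ≤ 4) : False := by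
  obtain ⟨ka, kc, kR⟩ := cubicL_frame P Q R hn h1 h2 h3 h4 h5 hb13 hb23
  obtain ⟨ka', kc', kR'⟩ := cubicL_frame P' Q' R' hn' h1' h2' h3' h4' h5' hb13' hb23'
  obtain ⟨ka'', kc'', kR''⟩ := cubicL_frame P'' Q'' R'' hn'' h1'' h2'' h3'' h4'' h5'' hb13'' hb23''
  -- the frame coordinates `a = (P+Q)/2 ≥ 1`, `b = (P−Q)/2`, `c = R − (P+Q)/2 > 0`
  obtain ⟨a, ha⟩ : ∃ a : ℝ, a = (P + Q) / 2 := ⟨_, rfl⟩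
  obtain ⟨b, hb⟩ : ∃ b : ℝ, b = (P - Q) / 2 := ⟨_, rfl⟩
  obtain ⟨c, hc⟩ : ∃ c : ℝ, c = R - (P + Q) / 2 := ⟨_, rfl⟩
  obtain ⟨a', ha'⟩ : ∃ a' : ℝ, a' = (P' + Q') / 2 := ⟨_, rfl⟩
  obtain ⟨b', hb'⟩ : ∃ b' : ℝ, b' = (P' - Q') / 2 := ⟨_, rfl⟩
  obtain ⟨c', hc'⟩ : ∃ c' : ℝ, c' = R' - (P' + Q') / 2 := ⟨_, rfl⟩
  obtain ⟨a'', ha''⟩ : ∃ a'' : ℝ, a'' = (P'' + Q'') / 2 := ⟨_, rfl⟩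
  obtain ⟨b'', hb''⟩ : ∃ b'' : ℝ, b'' = (P'' - Q'') / 2 := ⟨_, rfl⟩
  obtain ⟨c'', hc''⟩ : ∃ c'' : ℝ, c'' = R'' - (P'' + Q'') / 2 := ⟨_, rfl⟩
  have ga : 1 ≤ a := by linarith
  have ga' : 1 ≤ a' := by linarith
  have ga'' : 1 ≤ a'' := by linarith
  -- `c > 0`: `c = 0` would give `a ≤ 1` from `P + Q − R ≤ 1`, hence `R = a + c = 1`
  have pc : 0 < c := by
    rcases lt_or_eq_of_le (show 0 ≤ c by linarith) with h | h
    · exact h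
    · exfalso; linarith
  have pc' : 0 < c' := by
    rcases lt_or_eq_of_le (show 0 ≤ c' by linarith) with h | h
    · exact h
    · exfalso; linarith
  have pc'' : 0 < c'' := by
    rcases lt_or_eq_of_le (show 0 ≤ c'' by linarith) with h | h
    · exact h
    · exfalso; linarith
  -- pairwise `a a' + b b' + c c' ≤ 1`
  have e1 : P + Q = 2 * a := by linarith
  have e2 : P - Q = 2 * b := by linarith
  have e3 : 2 * R - P - Q = 2 * c := by linarith
  have e1' : P' + Q' = 2 * a' := by linarith
  have e2' : P' - Q' = 2 * b' := by linarith
  have e3' : 2 * R' - P' - Q' = 2 * c' := by linarith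
  have e1'' : P'' + Q'' = 2 * a'' := by linarith
  have e2'' : P'' - Q'' = 2 * b'' := by linarith
  have e3'' : 2 * R'' - P'' - Q'' = 2 * c'' := by linarith
  rw [e1, e2, e3, e1', e2', e3'] at hxy
  rw [e1, e2, e3, e1'', e2'', e3''] at hxz
  rw [e1', e2', e3', e1'', e2'', e3''] at hyz
  have i12 : a * a' + b * b' + c * c' ≤ 1 := by linarith [hxy]
  have i13 : a * a'' + b * b'' + c * c'' ≤ 1 := by linarith [hxz]
  have i23 : a' * a'' + b' * b'' + c' * c'' ≤ 1 := by linarith [hyz]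
  -- `a a' ≥ 1`, `c c' > 0`, so `b b' < 0` for each pair
  have j12 : b * b' < 0 := by
    linarith [mul_pos pc pc', mul_nonneg (sub_nonneg.2 ga) (sub_nonneg.2 ga')]
  have j13 : b * b'' < 0 := by
    linarith [mul_pos pc pc'', mul_nonneg (sub_nonneg.2 ga) (sub_nonneg.2 ga'')]
  have j23 : b' * b'' < 0 := by
    linarith [mul_pos pc' pc'', mul_nonneg (sub_nonneg.2 ga') (sub_nonneg.2 ga'')]
  -- three reals with pairwise negative products do not exist
  have hneg : (b * b') * (b * b'') * (b' * b'') < 0 :=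
    mul_neg_of_pos_of_neg (mul_pos_of_neg_of_neg j12 j13) j23
  have hsq : (b * b') * (b * b'') * (b' * b'') = (b * b' * b'') ^ 2 := by ring
  rw [hsq] at hneg
  exact absurd hneg (not_lt.2 (sq_nonneg _))

end Summit.Ventures.Crystal3D.Theorems

end
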